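import Summits.Ventures.HodgeRepro2.T5BergmanFourier

/-!
# The Taylor truncation is the orthogonal projection onto the first `K`-types

For `f = Σ a_n zⁿ ∈ A_k` (`k ≥ 2`) and the Taylor partial sum `S_N = Σ_{n<N} a_n zⁿ`:

* `⟨f - S_N, zⁿ⟩_k = 0` for `n < N` (`pairing_sub_partialSum_monomial`) and `⟨f - S_N, S_N⟩_k = 0`
  (`pairing_sub_partialSum_partialSum`): the remainder is orthogonal to the span of `1, z, …, z^{N-1}`,
  so `S_N` is the ORTHOGONAL PROJECTION of `f` onto the first `N` `K`-types;
* `⟨S_N, S_N⟩_k = Σ_{n<N} |a_n|² ⟨zⁿ, zⁿ⟩_k` (`pairing_partialSum_self`) and **Pythagoras**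
  `⟨f, f⟩_k = ⟨S_N, S_N⟩_k + ⟨f - S_N, f - S_N⟩_k` (`pythagoras`), hence **Bessel's inequality**
  `Σ_{n<N} |a_n|² ⟨zⁿ, zⁿ⟩_k ≤ ⟨f, f⟩_k` (`bessel`).

Together with `T5BergmanParseval.tendsto_pairing_sub_partialSum` this is the `K`-type projector of the
explicit model (the abstract projector of rows 111–116 made explicit: `f ↦ a_n zⁿ`).

Blind lane: Mathlib + the HodgeRepro2 prefix only; no sorry; axioms ⊆ {propext, Classical.choice,
Quot.sound}.
-/

namespace Summit.Ventures.HodgeRepro2.T5BergmanProjection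

open MeasureTheory Metric Filter Topology T5BergmanCoefficient T5BergmanPairing T5BergmanUnitary
  T5BergmanMonomialNorm T5BergmanParseval T5BergmanFourier
open scoped Real

/-- The truncated coefficient sequence of `f - S_N`. -/
lemma hasSum_sub_partialSum' (a : ℕ → ℂ) (f : ℂ → ℂ)
    (hf : ∀ z ∈ ball (0 : ℂ) 1, HasSum (fun n => a n * z ^ n) (f z)) (N : ℕ) :
    ∀ z ∈ ball (0 : ℂ) 1,
      HasSum (fun n => (if n < N then 0 else a n) * z ^ n) ((f - partialSum a N) z) :=
  fun _ hz => hasSum_sub_partialSum a f hf N hz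

/-- `f - S_N ∈ A_k`. -/
lemma integrableOn_sub_partialSum (k : ℕ) (hk : 2 ≤ k) (a : ℕ → ℂ) (f : ℂ → ℂ)
    (hf : ∀ z ∈ ball (0 : ℂ) 1, HasSum (fun n => a n * z ^ n) (f z))
    (hint : IntegrableOn (fun z => ‖f z‖ ^ 2 * (1 - ‖z‖ ^ 2) ^ (k - 2)) (ball (0 : ℂ) 1)) (N : ℕ) :
    IntegrableOn (fun z => ‖(f - partialSum a N) z‖ ^ 2 * (1 - ‖z‖ ^ 2) ^ (k - 2)) (ball (0 : ℂ) 1) := by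
  rw [integrableOn_iff_summable k hk _ _ (hasSum_sub_partialSum' a f hf N)]
  have hs := (integrableOn_iff_summable k hk a f hf).mp hint
  refine Summable.of_nonneg_of_le (fun n => mul_nonneg (by positivity) (monomialNormSq_pos k n).le)
    (fun n => ?_) hs
  split_ifs <;> simp [mul_nonneg, (monomialNormSq_pos k n).le]

/-- `S_N ∈ A_k` (a polynomial). -/
lemma integrableOn_partialSum (k : ℕ) (a : ℕ → ℂ) (N : ℕ) :
    IntegrableOn (fun z => ‖partialSum a N z‖ ^ 2 * (1 - ‖z‖ ^ 2) ^ (k - 2)) (ball (0 : ℂ) 1) :=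
  (((by fun_prop : Continuous (partialSum a N)).norm.pow 2).mul
    (by fun_prop : Continuous fun z : ℂ => (1 - ‖z‖ ^ 2) ^ (k - 2))).continuousOn.integrableOn_compact
    (isCompact_closedBall 0 1) |>.mono_set ball_subset_closedBall

/-- The coefficient sequence of `S_N`. -/
lemma hasSum_partialSum (a : ℕ → ℂ) (N : ℕ) (z : ℂ) :
    HasSum (fun n => (if n < N then a n else 0) * z ^ n) (partialSum a N z) := by
  have h : HasSum (fun n => (if n < N then a n else 0) * z ^ n)
      (∑ n ∈ Finset.range N, (if n < N then a n else 0) * z ^ n) :=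
    hasSum_sum_of_ne_finset_zero (fun n hn => by
      rw [Finset.mem_range] at hn
      simp [hn])
  convert h using 1
  apply Finset.sum_congr rfl
  intro n hn
  rw [Finset.mem_range] at hn
  simp [hn]

/-! ### Orthogonality of the remainder -/

/-- **`⟨f - S_N, zⁿ⟩_k = 0` for `n < N`**: the remainder is orthogonal to the first `N` `K`-types. -/
theorem pairing_sub_partialSum_monomial (k : ℕ) (hk : 2 ≤ k) (a : ℕ → ℂ) (f : ℂ → ℂ)
    (hf : ∀ z ∈ ball (0 : ℂ) 1, HasSum (fun n => a n * z ^ n) (f z))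
    (hint : IntegrableOn (fun z => ‖f z‖ ^ 2 * (1 - ‖z‖ ^ 2) ^ (k - 2)) (ball (0 : ℂ) 1))
    {N n : ℕ} (hn : n < N) :
    pairing k (f - partialSum a N) (fun w => w ^ n) = 0 := by
  rw [pairing_monomial_right k hk _ _ (hasSum_sub_partialSum' a f hf N)
    (integrableOn_sub_partialSum k hk a f hf hint N) n]
  simp [hn]

/-- **`⟨f - S_N, S_N⟩_k = 0`**: `S_N` is the orthogonal projection of `f`. -/
theorem pairing_sub_partialSum_partialSum (k : ℕ) (hk : 2 ≤ k) (a : ℕ → ℂ) (f : ℂ → ℂ)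
    (hf : ∀ z ∈ ball (0 : ℂ) 1, HasSum (fun n => a n * z ^ n) (f z))
    (hint : IntegrableOn (fun z => ‖f z‖ ^ 2 * (1 - ‖z‖ ^ 2) ^ (k - 2)) (ball (0 : ℂ) 1)) (N : ℕ) :
    pairing k (f - partialSum a N) (partialSum a N) = 0 := by
  have hfc : ContinuousOn (f - partialSum a N) (ball 0 1) :=
    (continuousOn_ball a f hf).sub (by fun_prop : Continuous (partialSum a N)).continuousOn
  have hfi := integrableOn_sub_partialSum k hk a f hf hint N
  -- `⟨g, Σ_{n<M} a_n zⁿ⟩ = Σ_{n<M} ā_n ⟨g, zⁿ⟩` by induction on `M`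
  have key : ∀ M : ℕ, pairing k (f - partialSum a N) (partialSum a M) =
      ∑ n ∈ Finset.range M, (starRingEnd ℂ) (a n) * pairing k (f - partialSum a N) (fun w => w ^ n) := by
    intro M
    induction M with
    | zero =>
      simp only [Finset.range_zero, Finset.sum_empty]
      unfold pairing
      simp [partialSum]
    | succ M ih =>
      have e : partialSum a (M + 1) = partialSum a M + fun w => a M * w ^ M := by
        ext w
        simp [partialSum, Finset.sum_range_succ]
      rw [e, pairing_add_right k
        (integrableOn_mul_conj k hfc (by fun_prop : Continuous (partialSum a M)).continuousOn hfi
          (integrableOn_partialSum k a M))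
        (integrableOn_mul_conj k hfc (by fun_prop : Continuous fun w : ℂ => a M * w ^ M).continuousOn hfi
          (by
            refine IntegrableOn.congr_fun ((integrableOn_monomial k M).const_mul (‖a M‖ ^ 2))
              (fun w _ => ?_) measurableSet_ball
            simp only [norm_mul, mul_pow]
            ring)),
        ih, pairing_const_mul_right, Finset.sum_range_succ]
  rw [key N]
  apply Finset.sum_eq_zero
  intro n hn
  rw [Finset.mem_range] at hn
  rw [pairing_sub_partialSum_monomial k hk a f hf hint hn, mul_zero]

/-! ### Pythagoras and Bessel -/

/-- **`⟨S_N, S_N⟩_k = Σ_{n<N} |a_n|² ⟨zⁿ, zⁿ⟩_k`** (finite Parseval). -/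
theorem pairing_partialSum_self (k : ℕ) (hk : 2 ≤ k) (a : ℕ → ℂ) (N : ℕ) :
    (pairing k (partialSum a N) (partialSum a N)).re =
      ∑ n ∈ Finset.range N, ‖a n‖ ^ 2 * monomialNormSq k n := by
  have h := hasSum_pairing_self k hk (fun n => if n < N then a n else 0) (partialSum a N)
    (fun z _ => hasSum_partialSum a N z) (integrableOn_partialSum k a N)
  have h2 : HasSum (fun n => ‖(if n < N then a n else 0)‖ ^ 2 * monomialNormSq k n)
      (∑ n ∈ Finset.range N, ‖a n‖ ^ 2 * monomialNormSq k n) := by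
    have this : HasSum (fun n => ‖(if n < N then a n else 0)‖ ^ 2 * monomialNormSq k n)
        (∑ n ∈ Finset.range N, ‖(if n < N then a n else 0)‖ ^ 2 * monomialNormSq k n) :=
      hasSum_sum_of_ne_finset_zero (fun n hn => by
        rw [Finset.mem_range] at hn
        simp [hn])
    convert this using 1
    apply Finset.sum_congr rfl
    intro n hn
    rw [Finset.mem_range] at hn
    simp [hn]
  exact h.unique h2

/-- **`⟨f - S_N, f - S_N⟩_k = Σ_{n≥N} |a_n|² ⟨zⁿ, zⁿ⟩_k`** (the tail of Parseval). -/
theorem pairing_sub_partialSum_self (k : ℕ) (hk : 2 ≤ k) (a : ℕ → ℂ) (f : ℂ → ℂ)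
    (hf : ∀ z ∈ ball (0 : ℂ) 1, HasSum (fun n => a n * z ^ n) (f z))
    (hint : IntegrableOn (fun z => ‖f z‖ ^ 2 * (1 - ‖z‖ ^ 2) ^ (k - 2)) (ball (0 : ℂ) 1)) (N : ℕ) :
    (pairing k (f - partialSum a N) (f - partialSum a N)).re =
      ∑' j, ‖a (j + N)‖ ^ 2 * monomialNormSq k (j + N) := by
  have h := hasSum_pairing_self k hk _ _ (hasSum_sub_partialSum' a f hf N)
    (integrableOn_sub_partialSum k hk a f hf hint N)
  have hs := (integrableOn_iff_summable k hk a f hf).mp hint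
  have htail : Summable (fun j => ‖a (j + N)‖ ^ 2 * monomialNormSq k (j + N)) :=
    (summable_nat_add_iff N).mpr hs
  have h2 : HasSum (fun n => ‖(if n < N then 0 else a n)‖ ^ 2 * monomialNormSq k n)
      (∑' j, ‖a (j + N)‖ ^ 2 * monomialNormSq k (j + N)) := by
    have e : (fun n => ‖(if n < N then 0 else a n)‖ ^ 2 * monomialNormSq k n) =
        fun n => if n < N then 0 else ‖a n‖ ^ 2 * monomialNormSq k n := by
      funext n
      split_ifs <;> simp
    rw [e]
    have hfin : ∑ i ∈ Finset.range N, (if i < N then 0 else ‖a i‖ ^ 2 * monomialNormSq k i) = 0 := by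
      apply Finset.sum_eq_zero
      intro i hi
      rw [Finset.mem_range] at hi
      simp [hi]
    rw [← hasSum_nat_add_iff' N, hfin, sub_zero]
    refine htail.hasSum.congr_fun fun n => ?_
    show (if n + N < N then 0 else ‖a (n + N)‖ ^ 2 * monomialNormSq k (n + N)) =
      ‖a (n + N)‖ ^ 2 * monomialNormSq k (n + N)
    rw [if_neg (by omega)]
  exact h.unique h2

/-- **Pythagoras**: `⟨f, f⟩_k = ⟨S_N, S_N⟩_k + ⟨f - S_N, f - S_N⟩_k`. -/
theorem pythagoras (k : ℕ) (hk : 2 ≤ k) (a : ℕ → ℂ) (f : ℂ → ℂ)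
    (hf : ∀ z ∈ ball (0 : ℂ) 1, HasSum (fun n => a n * z ^ n) (f z))
    (hint : IntegrableOn (fun z => ‖f z‖ ^ 2 * (1 - ‖z‖ ^ 2) ^ (k - 2)) (ball (0 : ℂ) 1)) (N : ℕ) :
    (pairing k f f).re =
      (pairing k (partialSum a N) (partialSum a N)).re +
        (pairing k (f - partialSum a N) (f - partialSum a N)).re := by
  rw [pairing_partialSum_self k hk a N, pairing_sub_partialSum_self k hk a f hf hint N,
    (hasSum_pairing_self k hk a f hf hint).tsum_eq.symm]
  have hs := (integrableOn_iff_summable k hk a f hf).mp hint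
  exact (hs.sum_add_tsum_nat_add N).symm

/-- **Bessel's inequality**: `Σ_{n<N} |a_n|² ⟨zⁿ, zⁿ⟩_k ≤ ⟨f, f⟩_k`. -/
theorem bessel (k : ℕ) (hk : 2 ≤ k) (a : ℕ → ℂ) (f : ℂ → ℂ)
    (hf : ∀ z ∈ ball (0 : ℂ) 1, HasSum (fun n => a n * z ^ n) (f z))
    (hint : IntegrableOn (fun z => ‖f z‖ ^ 2 * (1 - ‖z‖ ^ 2) ^ (k - 2)) (ball (0 : ℂ) 1)) (N : ℕ) :
    ∑ n ∈ Finset.range N, ‖a n‖ ^ 2 * monomialNormSq k n ≤ (pairing k f f).re := by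
  rw [pythagoras k hk a f hf hint N, pairing_partialSum_self k hk a N]
  linarith [(pairing_self_nonneg k (f - partialSum a N)).1]


end Summit.Ventures.HodgeRepro2.T5BergmanProjection
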